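import Summits.HodgeConjecture.HodgeConjecture.Theorems.Ring2AbelianAllAndreWeightLiftNodes
import Summits.HodgeConjecture.HodgeConjecture.Theorems.Ring2AbelianAllAndreInvariantHodgeTypes
import Summits.HodgeConjecture.HodgeConjecture.Theorems.Ring2AbelianAllAndreInvariantRationality
import Summits.HodgeConjecture.HodgeConjecture.Theorems.Ring2AbelianAllAndreTransportLattice
import Summits.HodgeConjecture.HodgeConjecture.Theorems.Ring2AbelianAllAndreFibreClassAlgebraicFibre
import Summits.HodgeConjecture.HodgeConjecture.Theorems.Ring2AbelianAllAndreWeilPencilsNumerical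
import HarnessLib

/-!
# Ring 2 · sub-cell AbelianAll (ALL ABELIAN VARIETIES), André axis, part XXIV-d — LERAY WEIGHTS: top-weight classes read their
# rationality and Hodge type on ONE fibre; a `B_min` CANDIDATE per weighted pencil (4-binder reading of (L); not below N104, not minimal —
# REFEREE-AB F-ab-107) = THE HODGE CONJECTURE FOR THE TOP-WEIGHT CLASSES OF THE TOTAL SPACE

HONEST FRAMING (page 1, verbatim): **research route, not a corollary; conditional on HC_CM plus one named
minimal statement.** Cell line: research route conditional on HC_CM; not a corollary; Q11.4-sentence-2
already refuted in dim ≥ 3. Nothing in this file proves a case of the Hodge conjecture for an abelian variety; `HC_CM`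
(`RankFourFaces.CMAbelianHodge`) is a HYPOTHESIS of the §10 rows that name it, load-bearing as typed; item
`Theses.RankFourFaces.CMToAbelian` (stmt-16267) OPEN and not closed here. Seat `pub-hodge-ring2-ab-andre-2`, gen 16; brief (ii)/(iii).

Hypotheses (wt), (wt₃), (top) on an endomorphism `ν` and a weight base `N ≥ 2` are those of part XXIV-a: PRINT theorems for `ν = θ_N` on an
abelian scheme over a curve (Kleiman 1968 p. 374; Milne 2020 proof of Prop. 1: «`Hⁱ(S, Rʲ f_*)` = the subspace of `H^{i+j}(A)` on which `θ_n`
acts as `nʲ`»; Deninger–Murre 1991 Thm. 3.1), NOT in the tree, displayed as hypotheses (brackets display-only, F-ab-103).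

## What is proved (theorems only; no definition, no named fact, no sorry)

§8 **`exists_topWeight_lift_rational`** ((wt), (wt₃): a RATIONAL class has a RATIONAL top-weight companion with the same restriction — the
weight projector has rational coefficients and `ν^*` preserves rational classes); **`isOfHodgeType_of_topWeight`** ((top): a top-weight class
whose restriction to `X_t` has type `(p,q)` HAS type `(p,q)` on `𝒳` — its other type components are top-weight (`ν^*` commutes with the type
projectors, part XVI-a) and die on `X_t`); **`isRationalClass_of_topWeight`** ((wt), (wt₃), (top): a top-weight class with rational restriction
IS rational — part XVII-a's rational lift, projected, and uniqueness). So the top-weight space `Hᵏ(𝒳)^{wt k}` (print: `H⁰(S, Rᵏ f_*)`) is a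
sub-Hodge structure read isomorphically on any fibre.
§9 **`comap_le_sup_of_forall_topWeight_hodge_mem`** — (wt), (wt₃), (top) in degree `2(p+1)`: [every top-weight RATIONAL `(p+1,p+1)`-class of
`𝒳` is algebraic] ⟹ (L)_t(p+1) (via part XVII-b's rational span of `(j_t^*)⁻¹N`); **`topWeight_hodge_mem_of_comap_le_sup`** — conversely, if the
rational `(p+1,p+1)`-classes of `X_t` are algebraic (a CM fibre under `HC_CM`; an `E`-power fibre unconditionally), (L)_t(p+1) ⟹ [that];
**`comap_le_sup_iff_forall_topWeight_hodge_mem`**. THE ANDRÉ-AXIS `B_min` CANDIDATE (4-binder reading of (L); not below N104, not minimal — F-ab-107)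
PER WEIGHTED PENCIL WITH AN HC-FIBRE IS THE HODGE CONJECTURE FOR THE
TOP-WEIGHT CLASSES OF THE TOTAL SPACE — a `t`-free statement about the sub-Hodge structure `H^{2p+2}(𝒳)^{wt 2p+2}`.
§10 Rows. `E`-power (no `HC_CM`): **`weilSixfolds_of_cmPowerWeilPencilsAt_of_topWeightHodge`** — `(W_E)₃ ∧ [at the E-power points of the compact
sextic pencils: a weighted endomorphism and "every top-weight rational `(p+1,p+1)`-class of the sevenfold is algebraic"] ⟹ WeilSixfolds`. CM
(display-only bracket `CMTopWeightHodge[]`): **`cmFibreAlgebraicLift_of_cmTopWeightHodge`** (K[`CMWeights[]`]),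
**`cmTopWeightHodge_of_cmFibreAlgebraicLift_of_HC_CM`** (K[HC_CM]), **`HC_AV_of_HC_CM_of_cmTopWeightHodge`** (binders [h₂₁], `CMWeights[]`,
`HC_CM`, bracket), on-path **`cmTopWeightHodge_of_HC_AV_of_verdier`**, **`HC_AV_iff_HC_CM_and_cmTopWeightHodge_of_verdier`** (mod [h₂₁, Verdier,
`CMWeights[]`]).

## Honest status

No node is born; nothing is minimal; nothing here is fact-free progress on `HC_AV`; the weights are print-not-tree. WHAT IS NEW: the cell's
deliverable on the André axis now reads, granted the print weights, **`HC_AV ⟺ HC_CM ∧ [the Hodge conjecture for the top-weight part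
`H⁰(S, R^{2p} f_*ℚ) ⊂ H^{2p}(𝒳)` of the total spaces of CM-pointed compact abelian pencils]`** — a Hodge conjecture for an explicit, small
sub-Hodge structure of a non-abelian variety, on which NO transcendental class interferes with the comparison to the fibre (the restriction
to any fibre is an injective morphism of Hodge structures onto the invariants). FIND-THE-CYCLE (W₆, large monodromy): `H⁰(S, R⁶ f_*ℚ) ⊂
H⁶(𝒳⁷, ℚ)` is then a rank-3 sub-Hodge structure CONSISTING OF HODGE CLASSES (`k₂³` and the canonical lifts of the two Weil classes); show
it consists of algebraic classes. References: Milne2020HodgeClassesAV (proof of Prop. 1, pp. 7–8); Kleiman1968AlgebraicCycles (p. 374);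
DeningerMurre1991 (Thm. 3.1); DeligneHodgeII1971 (Cor. 4.1.2, (4.1.3.1)); VoisinHodgeI2002 (§7.1.1); Andre1996Motifs (§5.1, §6.3);
vanGeemen1994HodgeAV (Thm. 6.12); Verdier1976 (Cor. 5.1).
-/

noncomputable section

set_option linter.dupNamespace false

namespace Summit.HodgeConjecture.HodgeConjecture.Ring2.AbelianAll

open CategoryTheory AlgebraicGeometry
open Literature.AlgebraicGeometry Literature.AlgebraicGeometry.Motives
open Literature.AlgebraicGeometry.HodgeTheory
open Literature.AlgebraicGeometry.Deligne1982 (cmLocus)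
open Literature.AlgebraicGeometry.Andre1996 (andre1996_cmAnchoredPencil)
open Summit.HodgeConjecture.HodgeConjecture
open Summit.HodgeConjecture.HodgeConjecture.Theses
open Summit.HodgeConjecture.HodgeConjecture.Ring2.Deform (HC_CM_of_HC_AV)
open Summit.HodgeConjecture.HodgeConjecture.Ring2.Hypotheses (cmPowerLocus)

/-! ## §8 Top-weight classes: rationality and Hodge type are read on one fibre -/

section TopWeightHodge

variable {𝒳 S : SchemeOver ℂ} {d : ℕ} {f : 𝒳 ⟶ S}

/-- **A RATIONAL class has a RATIONAL top-weight companion with the same restriction to `X_t`** ((wt), (wt₃) in degree `2(p+1)`): the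
top-weight component is the Lagrange polynomial `(ν^*−N^{2p+1})(ν^*−N^{2p})/((N^{2p+2}−N^{2p+1})(N^{2p+2}−N^{2p}))` (rational
coefficients; `ν^*` preserves rational classes) applied to the class, and the lower weights die on the fibre. [cite: Milne2020HodgeClassesAV, proof of Prop. 1 (p. 7)]
[cite: VoisinHodgeI2002, §7.1.1] -/
theorem exists_topWeight_lift_rational (t : ComplexPoints S) (ν : 𝒳 ⟶ 𝒳) {N : ℕ} (hN : 2 ≤ N) {p : ℕ}
    (hwt : ∀ w : complexBetti 𝒳 (2 * (p + 1)), complexBetti.map (fiberι f t) (2 * (p + 1)) (complexBetti.map ν (2 * (p + 1)) w) =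
      ((N : ℂ) ^ (2 * (p + 1))) • complexBetti.map (fiberι f t) (2 * (p + 1)) w)
    (hwt₃ : ∀ w : complexBetti 𝒳 (2 * (p + 1)), ∃ w₀ w₁ w₂ : complexBetti 𝒳 (2 * (p + 1)), w = w₀ + w₁ + w₂ ∧
      complexBetti.map ν (2 * (p + 1)) w₀ = ((N : ℂ) ^ (2 * (p + 1))) • w₀ ∧
      complexBetti.map ν (2 * (p + 1)) w₁ = ((N : ℂ) ^ (2 * p + 1)) • w₁ ∧
      complexBetti.map ν (2 * (p + 1)) w₂ = ((N : ℂ) ^ (2 * p)) • w₂)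
    {W : complexBetti 𝒳 (2 * (p + 1))} (hW : IsRationalClass W) :
    ∃ W₀ : complexBetti 𝒳 (2 * (p + 1)), IsRationalClass W₀ ∧
      complexBetti.map ν (2 * (p + 1)) W₀ = ((N : ℂ) ^ (2 * (p + 1))) • W₀ ∧
      complexBetti.map (fiberι f t) (2 * (p + 1)) W₀ = complexBetti.map (fiberι f t) (2 * (p + 1)) W := by
  obtain ⟨w₀, w₁, w₂, hsum, h₀, h₁, h₂⟩ := hwt₃ W
  set T : Module.End ℂ (complexBetti 𝒳 (2 * (p + 1))) := (complexBetti.map ν (2 * (p + 1))).hom with hT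
  have hT' : ∀ w, T w = complexBetti.map ν (2 * (p + 1)) w := fun _ ↦ rfl
  have hTQ : ∀ w : complexBetti 𝒳 (2 * (p + 1)), IsRationalClass w → IsRationalClass (T w) :=
    fun w hw ↦ hw.map (AlgPoints.mapContinuous (L := ℂ) ν)
  set q₀ : ℂ := (N : ℂ) ^ (2 * (p + 1))
  set q₁ : ℂ := (N : ℂ) ^ (2 * p + 1)
  set q₂ : ℂ := (N : ℂ) ^ (2 * p)
  set r₁ : ℚ := -((N : ℚ) ^ (2 * p + 1) + (N : ℚ) ^ (2 * p))
  set r₂ : ℚ := (N : ℚ) ^ (2 * p + 1) * (N : ℚ) ^ (2 * p)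
  set cq : ℚ := (((N : ℚ) ^ (2 * (p + 1)) - (N : ℚ) ^ (2 * p + 1)) * ((N : ℚ) ^ (2 * (p + 1)) - (N : ℚ) ^ (2 * p)))⁻¹
  have hc : (q₀ - q₁) * (q₀ - q₂) ≠ 0 :=
    mul_ne_zero (natCast_pow_sub_pow_ne_zero hN (by omega)) (natCast_pow_sub_pow_ne_zero hN (by omega))
  have hr₁ : ((r₁ : ℚ) : ℂ) = -(q₁ + q₂) := by
    simp only [r₁, q₁, q₂]
    push_cast
    rfl
  have hr₂ : ((r₂ : ℚ) : ℂ) = q₁ * q₂ := by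
    simp only [r₂, q₁, q₂]
    push_cast
    rfl
  have hcq : ((cq : ℚ) : ℂ) = ((q₀ - q₁) * (q₀ - q₂))⁻¹ := by
    simp only [cq, q₀, q₁, q₂]
    push_cast
    rfl
  have hLag : T (T W) + ((r₁ : ℚ) : ℂ) • T W + ((r₂ : ℚ) : ℂ) • W = ((q₀ - q₁) * (q₀ - q₂)) • w₀ := by
    rw [hr₁, hr₂]
    simp only [hT', hsum, map_add, h₀, h₁, h₂, map_smul, smul_add, smul_smul]
    module
  have hQ : IsRationalClass (T (T W) + ((r₁ : ℚ) : ℂ) • T W + ((r₂ : ℚ) : ℂ) • W) :=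
    IsRationalClass.add (IsRationalClass.add (hTQ _ (hTQ _ hW)) (IsRationalClass.smul (hTQ _ hW) r₁))
      (IsRationalClass.smul hW r₂)
  have hw₀ : ((cq : ℚ) : ℂ) • (T (T W) + ((r₁ : ℚ) : ℂ) • T W + ((r₂ : ℚ) : ℂ) • W) = w₀ := by
    rw [hLag, hcq, smul_smul, inv_mul_cancel₀ hc, one_smul]
  refine ⟨w₀, ?_, h₀, ?_⟩
  · rw [← hw₀]
    exact IsRationalClass.smul hQ cq
  · rw [hsum, map_add, map_add, map_fiberι_eq_zero_of_weight_lt t ν hN (by omega : 2 * p + 1 < 2 * (p + 1)) hwt h₁,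
      map_fiberι_eq_zero_of_weight_lt t ν hN (by omega : 2 * p < 2 * (p + 1)) hwt h₂, add_zero, add_zero]

/-- **A TOP-WEIGHT CLASS READS ITS HODGE TYPE ON ONE FIBRE** ((top) in degree `k`): if `ν^* y₀ = Nᵏ y₀` and `j_t^* y₀` has Hodge type
`(p,q)` on `X_t`, then `y₀` has type `(p,q)` on `𝒳`. Proof: in one Hodge model `A` of `𝒳`, the other type components `π_{(p',q')} y₀` are
again of top weight (`ν^*` commutes with the type projectors, part XVI-a `typeProj_map_comm`) and die on `X_t` (the type criterion for
`j_t^*`, part XVI-a `isOfHodgeType_map_iff_forall_typeProj`), hence vanish by (top). Print: the Hodge structure of `H⁰(S, Rᵏ f_*)` is a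
sub-Hodge structure of `Hᵏ(X_t)` for every `t`. [cite: DeligneHodgeII1971, Cor. 4.1.2 and (4.1.3.1)] [cite: VoisinHodgeI2002, §7.1.1]
[cite: Milne2020HodgeClassesAV, proof of Prop. 1 (p. 7)] -/
theorem isOfHodgeType_of_topWeight (hf : IsCompactAbelianPencil f d) (t : ComplexPoints S) (ν : 𝒳 ⟶ 𝒳) {N k p q : ℕ}
    (hpq : p + q = k)
    (htop : ∀ G : complexBetti 𝒳 k, complexBetti.map ν k G = ((N : ℂ) ^ k) • G → complexBetti.map (fiberι f t) k G = 0 → G = 0)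
    {y₀ : complexBetti 𝒳 k} (hy₀ : complexBetti.map ν k y₀ = ((N : ℂ) ^ k) • y₀)
    (hH : IsOfHodgeType d (fiberOver f t) k p q (complexBetti.map (fiberι f t) k y₀)) : IsOfHodgeType (d + 1) 𝒳 k p q y₀ := by
  have h𝒳 := hf.isSmoothProjective_total
  have hXt := hf.isSmoothProjective_fiberOver t
  obtain ⟨A⟩ := nonempty_hodgeModel_holds h𝒳
  have hmem : (p, q) ∈ Finset.HasAntidiagonal.antidiagonal k := Finset.HasAntidiagonal.mem_antidiagonal.2 hpq
  have hcomp := (isOfHodgeType_map_iff_forall_typeProj h𝒳 hXt (fiberι f t) A hpq y₀).1 hH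
  -- every other type component is top-weight and dies on the fibre, hence vanishes
  have hzero : ∀ pq' : ↥(Finset.HasAntidiagonal.antidiagonal k), pq'.1 ≠ (p, q) → A.typeProj k pq' y₀ = 0 := by
    intro pq' hne
    refine htop _ ?_ (hcomp pq' hne)
    rw [← typeProj_map_comm h𝒳 h𝒳 ν A A k pq' y₀, hy₀, map_smul]
  have hsum : y₀ = A.typeProj k ⟨(p, q), hmem⟩ y₀ := by
    conv_lhs => rw [← A.sum_typeProj k y₀]
    rw [Finset.sum_eq_single ⟨(p, q), hmem⟩]
    · intro pq' _ hne
      exact hzero pq' fun heq ↦ hne (Subtype.ext heq)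
    · intro habs
      exact absurd (Finset.mem_univ _) habs
  have h := A.isOfHodgeType_of_mem_typePiece (A.typeProj_mem k ⟨(p, q), hmem⟩ y₀)
  dsimp only at h
  rw [← hsum] at h
  exact h

/-- **A TOP-WEIGHT CLASS READS ITS RATIONALITY ON ONE FIBRE** ((wt), (wt₃), (top) in degree `2(p+1)`): if `j_t^* y₀` is rational then so
is `y₀` — a RATIONAL global class with the same fibre restrictions exists (part XVII-a), its top-weight companion is rational (§8) and equals
`y₀` by uniqueness (top). [cite: VoisinHodgeI2002, §7.1.1] [cite: Milne2020HodgeClassesAV, proof of Prop. 1 (p. 7)] -/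
theorem isRationalClass_of_topWeight (hf : IsCompactAbelianPencil f d) (t : ComplexPoints S) (ν : 𝒳 ⟶ 𝒳) {N : ℕ} (hN : 2 ≤ N) {p : ℕ}
    (hwt : ∀ w : complexBetti 𝒳 (2 * (p + 1)), complexBetti.map (fiberι f t) (2 * (p + 1)) (complexBetti.map ν (2 * (p + 1)) w) =
      ((N : ℂ) ^ (2 * (p + 1))) • complexBetti.map (fiberι f t) (2 * (p + 1)) w)
    (hwt₃ : ∀ w : complexBetti 𝒳 (2 * (p + 1)), ∃ w₀ w₁ w₂ : complexBetti 𝒳 (2 * (p + 1)), w = w₀ + w₁ + w₂ ∧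
      complexBetti.map ν (2 * (p + 1)) w₀ = ((N : ℂ) ^ (2 * (p + 1))) • w₀ ∧
      complexBetti.map ν (2 * (p + 1)) w₁ = ((N : ℂ) ^ (2 * p + 1)) • w₁ ∧
      complexBetti.map ν (2 * (p + 1)) w₂ = ((N : ℂ) ^ (2 * p)) • w₂)
    (htop : ∀ G : complexBetti 𝒳 (2 * (p + 1)), complexBetti.map ν (2 * (p + 1)) G = ((N : ℂ) ^ (2 * (p + 1))) • G →
      complexBetti.map (fiberι f t) (2 * (p + 1)) G = 0 → G = 0)
    {y₀ : complexBetti 𝒳 (2 * (p + 1))} (hy₀ : complexBetti.map ν (2 * (p + 1)) y₀ = ((N : ℂ) ^ (2 * (p + 1))) • y₀)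
    (hQ : IsRationalClass (complexBetti.map (fiberι f t) (2 * (p + 1)) y₀)) : IsRationalClass y₀ := by
  obtain ⟨W, hWQ, hWs⟩ := exists_isRationalClass_map_fiberι_eq hf y₀ hQ
  obtain ⟨W₀, hW₀Q, hW₀wt, hW₀j⟩ := exists_topWeight_lift_rational t ν hN hwt hwt₃ hWQ
  rw [topWeight_eq_of_map_fiberι_eq t ν htop hy₀ hW₀wt (by rw [hW₀j, hWs t])]
  exact hW₀Q

end TopWeightHodge

/-! ## §9 (L)_t(p+1) ⟺ the Hodge conjecture for the top-weight classes of `𝒳` in degree `2(p+1)` -/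

section TopWeightHC

variable {𝒳 S : SchemeOver ℂ} {d : ℕ} {f : 𝒳 ⟶ S}

/-- **[every top-weight rational `(p+1,p+1)`-class of `𝒳` is algebraic] ⟹ (L)_t(p+1)** ((wt), (wt₃), (top) in degree `2(p+1)`; NO
hypothesis on the fibre). Proof: `(j_t^*)⁻¹ N^{p+1}(X_t)` is spanned by its RATIONAL members (part XVII-b); the top-weight companion `W₀` of
a rational member `W` is rational, restricts to the algebraic — hence `(p+1,p+1)` — class `j_t^* W`, so is of type `(p+1,p+1)` on `𝒳` (§8),
hence algebraic by hypothesis; and `W − W₀` dies on `X_t`. [cite: Milne2020HodgeClassesAV, proof of Prop. 1 (pp. 7–8)]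
[cite: GrothendieckTopology1969, §1 p. 299] [cite: VoisinHodgeI2002, §7.1.1 and §11.3] -/
theorem comap_le_sup_of_forall_topWeight_hodge_mem (hf : IsCompactAbelianPencil f d) (t : ComplexPoints S) (ν : 𝒳 ⟶ 𝒳)
    {N : ℕ} (hN : 2 ≤ N) {p : ℕ}
    (hwt : ∀ w : complexBetti 𝒳 (2 * (p + 1)), complexBetti.map (fiberι f t) (2 * (p + 1)) (complexBetti.map ν (2 * (p + 1)) w) =
      ((N : ℂ) ^ (2 * (p + 1))) • complexBetti.map (fiberι f t) (2 * (p + 1)) w)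
    (hwt₃ : ∀ w : complexBetti 𝒳 (2 * (p + 1)), ∃ w₀ w₁ w₂ : complexBetti 𝒳 (2 * (p + 1)), w = w₀ + w₁ + w₂ ∧
      complexBetti.map ν (2 * (p + 1)) w₀ = ((N : ℂ) ^ (2 * (p + 1))) • w₀ ∧
      complexBetti.map ν (2 * (p + 1)) w₁ = ((N : ℂ) ^ (2 * p + 1)) • w₁ ∧
      complexBetti.map ν (2 * (p + 1)) w₂ = ((N : ℂ) ^ (2 * p)) • w₂)
    (htop : ∀ G : complexBetti 𝒳 (2 * (p + 1)), complexBetti.map ν (2 * (p + 1)) G = ((N : ℂ) ^ (2 * (p + 1))) • G →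
      complexBetti.map (fiberι f t) (2 * (p + 1)) G = 0 → G = 0)
    (h : ∀ y₀ : complexBetti 𝒳 (2 * (p + 1)), complexBetti.map ν (2 * (p + 1)) y₀ = ((N : ℂ) ^ (2 * (p + 1))) • y₀ →
      IsRationalClass y₀ → IsOfHodgeType (d + 1) 𝒳 (2 * (p + 1)) (p + 1) (p + 1) y₀ → y₀ ∈ algebraicClasses 𝒳 (p + 1)) :
    (algebraicClasses (fiberOver f t) (p + 1)).comap (complexBetti.map (fiberι f t) (2 * (p + 1))).hom ≤
      algebraicClasses 𝒳 (p + 1) ⊔ LinearMap.ker (complexBetti.map (fiberι f t) (2 * (p + 1))).hom := by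
  have hXt := hf.isSmoothProjective_fiberOver t
  intro W hW
  have hW' : complexBetti.map (fiberι f t) (2 * (p + 1)) W ∈ algebraicClasses (fiberOver f t) (p + 1) := hW
  refine (Submodule.span_le (p := algebraicClasses 𝒳 (p + 1) ⊔ LinearMap.ker (complexBetti.map (fiberι f t) (2 * (p + 1))).hom)).2
    ?_ (mem_span_rational_of_map_fiberι_mem_algebraicClasses hf hW')
  rintro W' ⟨hW'Q, hW'alg⟩
  obtain ⟨W₀, hW₀Q, hW₀wt, hW₀j⟩ := exists_topWeight_lift_rational t ν hN hwt hwt₃ hW'Q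
  have hH : IsOfHodgeType (d + 1) 𝒳 (2 * (p + 1)) (p + 1) (p + 1) W₀ :=
    isOfHodgeType_of_topWeight hf t ν (by omega) htop hW₀wt
      (by rw [hW₀j]; exact isOfHodgeType_of_mem_algebraicClasses_of_isSmoothProjective hXt (p + 1) hW'alg)
  have hW₀alg : W₀ ∈ algebraicClasses 𝒳 (p + 1) := h W₀ hW₀wt hW₀Q hH
  change W' ∈ algebraicClasses 𝒳 (p + 1) ⊔ LinearMap.ker (complexBetti.map (fiberι f t) (2 * (p + 1))).hom
  rw [show W' = W₀ + (W' - W₀) by abel]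
  refine Submodule.add_mem_sup hW₀alg ?_
  rw [LinearMap.mem_ker, map_sub, sub_eq_zero]
  exact hW₀j.symm

/-- **(L)_t(p+1) ⟹ [every top-weight rational `(p+1,p+1)`-class of `𝒳` is algebraic], at a fibre whose rational `(p+1,p+1)`-classes are
algebraic** (an `E`-power fibre; a CM fibre under `HC_CM`): the restriction of such a class is a rational `(p+1,p+1)`-class of `X_t`, hence
algebraic, and part XXIV-b §4 applies. [cite: Milne2020HodgeClassesAV, proof of Prop. 1 (pp. 7–8)] [cite: VoisinHodgeI2002, §7.1.1 and §11.3] -/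
theorem topWeight_hodge_mem_of_comap_le_sup (hf : IsCompactAbelianPencil f d) (t : ComplexPoints S) (ν : 𝒳 ⟶ 𝒳)
    [LocallyQuasiFinite ν.left] {N : ℕ} (hN : 2 ≤ N) {p : ℕ}
    (hwt : ∀ w : complexBetti 𝒳 (2 * (p + 1)), complexBetti.map (fiberι f t) (2 * (p + 1)) (complexBetti.map ν (2 * (p + 1)) w) =
      ((N : ℂ) ^ (2 * (p + 1))) • complexBetti.map (fiberι f t) (2 * (p + 1)) w)
    (hwt₃ : ∀ w : complexBetti 𝒳 (2 * (p + 1)), ∃ w₀ w₁ w₂ : complexBetti 𝒳 (2 * (p + 1)), w = w₀ + w₁ + w₂ ∧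
      complexBetti.map ν (2 * (p + 1)) w₀ = ((N : ℂ) ^ (2 * (p + 1))) • w₀ ∧
      complexBetti.map ν (2 * (p + 1)) w₁ = ((N : ℂ) ^ (2 * p + 1)) • w₁ ∧
      complexBetti.map ν (2 * (p + 1)) w₂ = ((N : ℂ) ^ (2 * p)) • w₂)
    (htop : ∀ G : complexBetti 𝒳 (2 * (p + 1)), complexBetti.map ν (2 * (p + 1)) G = ((N : ℂ) ^ (2 * (p + 1))) • G →
      complexBetti.map (fiberι f t) (2 * (p + 1)) G = 0 → G = 0)
    (hfib : ∀ c : complexBetti (fiberOver f t) (2 * (p + 1)), IsRationalClass c →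
      IsOfHodgeType d (fiberOver f t) (2 * (p + 1)) (p + 1) (p + 1) c → c ∈ algebraicClasses (fiberOver f t) (p + 1))
    (hL : (algebraicClasses (fiberOver f t) (p + 1)).comap (complexBetti.map (fiberι f t) (2 * (p + 1))).hom ≤
      algebraicClasses 𝒳 (p + 1) ⊔ LinearMap.ker (complexBetti.map (fiberι f t) (2 * (p + 1))).hom) :
    ∀ y₀ : complexBetti 𝒳 (2 * (p + 1)), complexBetti.map ν (2 * (p + 1)) y₀ = ((N : ℂ) ^ (2 * (p + 1))) • y₀ →
      IsRationalClass y₀ → IsOfHodgeType (d + 1) 𝒳 (2 * (p + 1)) (p + 1) (p + 1) y₀ → y₀ ∈ algebraicClasses 𝒳 (p + 1) := by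
  intro y₀ hy₀ hQ hH
  refine (comap_le_sup_iff_forall_topWeight_mem hf t ν hN hwt hwt₃ htop).1 hL y₀ hy₀ (hfib _ ?_ ?_)
  · exact hQ.map (AlgPoints.mapContinuous (L := ℂ) (fiberι f t))
  · exact hH.map_of_isSmoothProjective (hf.isSmoothProjective_fiberOver t) hf.isSmoothProjective_total (fiberι f t)

/-- **(L)_t(p+1) ⟺ THE HODGE CONJECTURE FOR THE TOP-WEIGHT CLASSES OF `𝒳` IN DEGREE `2(p+1)`**, at a fibre whose rational
`(p+1,p+1)`-classes are algebraic and for a locally quasi-finite weighted endomorphism (print: `θ_N`). The top-weight space is `t`-free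
(print: `H⁰(S, R^{2p+2} f_*ℚ)`), a sub-Hodge structure of `H^{2p+2}(𝒳)` read isomorphically on every fibre (§8).
[cite: Milne2020HodgeClassesAV, proof of Prop. 1 (pp. 7–8)] [cite: DeningerMurre1991, Thm. 3.1] [cite: VoisinHodgeI2002, §11.3 Conj. 11.24] -/
theorem comap_le_sup_iff_forall_topWeight_hodge_mem (hf : IsCompactAbelianPencil f d) (t : ComplexPoints S) (ν : 𝒳 ⟶ 𝒳)
    [LocallyQuasiFinite ν.left] {N : ℕ} (hN : 2 ≤ N) {p : ℕ}
    (hwt : ∀ w : complexBetti 𝒳 (2 * (p + 1)), complexBetti.map (fiberι f t) (2 * (p + 1)) (complexBetti.map ν (2 * (p + 1)) w) =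
      ((N : ℂ) ^ (2 * (p + 1))) • complexBetti.map (fiberι f t) (2 * (p + 1)) w)
    (hwt₃ : ∀ w : complexBetti 𝒳 (2 * (p + 1)), ∃ w₀ w₁ w₂ : complexBetti 𝒳 (2 * (p + 1)), w = w₀ + w₁ + w₂ ∧
      complexBetti.map ν (2 * (p + 1)) w₀ = ((N : ℂ) ^ (2 * (p + 1))) • w₀ ∧
      complexBetti.map ν (2 * (p + 1)) w₁ = ((N : ℂ) ^ (2 * p + 1)) • w₁ ∧
      complexBetti.map ν (2 * (p + 1)) w₂ = ((N : ℂ) ^ (2 * p)) • w₂)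
    (htop : ∀ G : complexBetti 𝒳 (2 * (p + 1)), complexBetti.map ν (2 * (p + 1)) G = ((N : ℂ) ^ (2 * (p + 1))) • G →
      complexBetti.map (fiberι f t) (2 * (p + 1)) G = 0 → G = 0)
    (hfib : ∀ c : complexBetti (fiberOver f t) (2 * (p + 1)), IsRationalClass c →
      IsOfHodgeType d (fiberOver f t) (2 * (p + 1)) (p + 1) (p + 1) c → c ∈ algebraicClasses (fiberOver f t) (p + 1)) :
    (algebraicClasses (fiberOver f t) (p + 1)).comap (complexBetti.map (fiberι f t) (2 * (p + 1))).hom ≤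
        algebraicClasses 𝒳 (p + 1) ⊔ LinearMap.ker (complexBetti.map (fiberι f t) (2 * (p + 1))).hom ↔
      ∀ y₀ : complexBetti 𝒳 (2 * (p + 1)), complexBetti.map ν (2 * (p + 1)) y₀ = ((N : ℂ) ^ (2 * (p + 1))) • y₀ →
        IsRationalClass y₀ → IsOfHodgeType (d + 1) 𝒳 (2 * (p + 1)) (p + 1) (p + 1) y₀ → y₀ ∈ algebraicClasses 𝒳 (p + 1) :=
  ⟨topWeight_hodge_mem_of_comap_le_sup hf t ν hN hwt hwt₃ htop hfib, comap_le_sup_of_forall_topWeight_hodge_mem hf t ν hN hwt hwt₃ htop⟩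

end TopWeightHC

/-! ## §10 Rows: the `E`-power W₆ row and the CM node level (display-only brackets) -/

section Rows

/-- DISPLAY-ONLY bracket (no `def`; REFEREE-AB F-ab-103): `CMWeights[]` of part XXIV-c, restated verbatim (weights at every CM point). -/
local notation3 (prettyPrint := false) "CMWeights[]" =>
  ∀ ⦃d : ℕ⦄ ⦃𝒳 S : SchemeOver ℂ⦄ (f : 𝒳 ⟶ S), IsCompactAbelianPencil f d → ∀ t ∈ cmLocus f d,
    ∃ (ν : 𝒳 ⟶ 𝒳) (_ : LocallyQuasiFinite ν.left) (N : ℕ), 2 ≤ N ∧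
      (∀ (k : ℕ) (w : complexBetti 𝒳 k), complexBetti.map (fiberι f t) k (complexBetti.map ν k w) =
        ((N : ℂ) ^ k) • complexBetti.map (fiberι f t) k w) ∧
      (∀ (k k₁ k₂ : ℕ), k₁ + 1 = k → k₂ + 1 = k₁ → ∀ w : complexBetti 𝒳 k, ∃ w₀ w₁ w₂ : complexBetti 𝒳 k,
        w = w₀ + w₁ + w₂ ∧ complexBetti.map ν k w₀ = ((N : ℂ) ^ k) • w₀ ∧ complexBetti.map ν k w₁ = ((N : ℂ) ^ k₁) • w₁ ∧
        complexBetti.map ν k w₂ = ((N : ℂ) ^ k₂) • w₂) ∧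
      (∀ (k : ℕ) (G : complexBetti 𝒳 k), complexBetti.map ν k G = ((N : ℂ) ^ k) • G →
        complexBetti.map (fiberι f t) k G = 0 → G = 0)

/-- DISPLAY-ONLY bracket (no `def`; REFEREE-AB F-ab-103): **CM TOP-WEIGHT HODGE CLASSES** — on every compact pencil of abelian varieties,
at every CM point `t`, for every locally quasi-finite endomorphism with the Leray weights in every degree: every TOP-WEIGHT RATIONAL
`(p+1,p+1)`-CLASS of the total space `𝒳` is algebraic ("the Hodge conjecture for `H⁰(S, R^{2p+2} f_*ℚ) ⊂ H^{2p+2}(𝒳)`"). OPEN; a HYPOTHESIS. -/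
local notation3 (prettyPrint := false) "CMTopWeightHodge[]" =>
  ∀ ⦃d : ℕ⦄ ⦃𝒳 S : SchemeOver ℂ⦄ (f : 𝒳 ⟶ S), IsCompactAbelianPencil f d → ∀ t ∈ cmLocus f d,
    ∀ (ν : 𝒳 ⟶ 𝒳) (_ : LocallyQuasiFinite ν.left) (N : ℕ), 2 ≤ N →
      (∀ (k : ℕ) (w : complexBetti 𝒳 k), complexBetti.map (fiberι f t) k (complexBetti.map ν k w) =
        ((N : ℂ) ^ k) • complexBetti.map (fiberι f t) k w) →
      (∀ (k k₁ k₂ : ℕ), k₁ + 1 = k → k₂ + 1 = k₁ → ∀ w : complexBetti 𝒳 k, ∃ w₀ w₁ w₂ : complexBetti 𝒳 k,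
        w = w₀ + w₁ + w₂ ∧ complexBetti.map ν k w₀ = ((N : ℂ) ^ k) • w₀ ∧ complexBetti.map ν k w₁ = ((N : ℂ) ^ k₁) • w₁ ∧
        complexBetti.map ν k w₂ = ((N : ℂ) ^ k₂) • w₂) →
      (∀ (k : ℕ) (G : complexBetti 𝒳 k), complexBetti.map ν k G = ((N : ℂ) ^ k) • G →
        complexBetti.map (fiberι f t) k G = 0 → G = 0) →
      ∀ (p : ℕ) (y₀ : complexBetti 𝒳 (2 * (p + 1))),
        complexBetti.map ν (2 * (p + 1)) y₀ = ((N : ℂ) ^ (2 * (p + 1))) • y₀ → IsRationalClass y₀ →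
        IsOfHodgeType (d + 1) 𝒳 (2 * (p + 1)) (p + 1) (p + 1) y₀ → y₀ ∈ algebraicClasses 𝒳 (p + 1)

/-- **[CM top-weight Hodge classes algebraic] ⟹ (L), granted `CMWeights[]`** (§9 ⟸ at the weighted endomorphism the bracket supplies;
degree `0` by the tree's `comap_le_sup_of_extreme`). [cite: Milne2020HodgeClassesAV, proof of Prop. 1 (pp. 7–8)] [cite: Andre1996Motifs, §5.1 (p. 25)] -/
theorem cmFibreAlgebraicLift_of_cmTopWeightHodge (hW : CMWeights[]) (h : CMTopWeightHodge[]) : CMFibreAlgebraicLift := by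
  refine cmFibreAlgebraicLift_iff_comap_le_sup.2 fun d 𝒳 S f hf p t ht ↦ ?_
  cases p with
  | zero => exact comap_le_sup_of_extreme hf t (show 0 + d = d by omega) (Or.inl (by omega))
  | succ p =>
    obtain ⟨ν, _, N, hN, hwt, hwt₃, htop⟩ := hW f hf t ht
    exact comap_le_sup_of_forall_topWeight_hodge_mem hf t ν hN (hwt _) (hwt₃ (2 * (p + 1)) (2 * p + 1) (2 * p) (by omega) (by omega))
      (htop _) (h f hf t ht ν inferInstance N hN hwt hwt₃ htop p)

/-- **`HC_CM ∧ (L) ⟹ [CM top-weight Hodge classes algebraic]`** (§9 ⟹: at a CM fibre `HC_CM` makes the rational `(p+1,p+1)`-classes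
algebraic, `Ring2Transport.mem_algebraicClasses_of_cmChart`). `HC_CM` a HYPOTHESIS, load-bearing. [cite: Milne2020HodgeClassesAV, proof of Prop. 1 (pp. 7–8)]
[cite: Andre1996Motifs, §5.1 (p. 25) and §6.3 (p. 33)] -/
theorem cmTopWeightHodge_of_cmFibreAlgebraicLift_of_HC_CM (hCM : RankFourFaces.CMAbelianHodge) (hL : CMFibreAlgebraicLift) :
    CMTopWeightHodge[] := by
  intro d 𝒳 S f hf t ht ν _ N hN hwt hwt₃ htop p
  obtain ⟨A₀, ⟨e₀⟩, hdim, hcm⟩ := ht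
  exact topWeight_hodge_mem_of_comap_le_sup hf t ν hN (hwt _) (hwt₃ (2 * (p + 1)) (2 * p + 1) (2 * p) (by omega) (by omega))
    (htop _) (fun c hc hcpp ↦ Ring2Transport.mem_algebraicClasses_of_cmChart hCM A₀ e₀ hdim hcm hc hcpp)
    (cmFibreAlgebraicLift_iff_comap_le_sup.1 hL f hf (p + 1) t ⟨A₀, ⟨e₀⟩, hdim, hcm⟩)

/-- **ON-PATH: `HC_AV` ⟹ [CM top-weight Hodge classes algebraic]** (granted Verdier for part XX's spreading; `HC_AV ⟹ HC_CM` is the tree's).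
[cite: Verdier1976, Cor. 5.1] [cite: Andre1996Motifs, §6.3 (p. 33)] -/
theorem cmTopWeightHodge_of_HC_AV_of_verdier (hGT : Verdier1976_genericLocalTriviality) (h : PadicSemiregularLift.HodgeAbelianVarieties) :
    CMTopWeightHodge[] :=
  cmTopWeightHodge_of_cmFibreAlgebraicLift_of_HC_CM (HC_CM_of_HC_AV h) (cmFibreAlgebraicLift_of_HC_AV_of_verdier hGT h)

/-- **`HC_CM ∧ [CM top-weight Hodge classes algebraic] ⟹ HC_AV`, granted [h₂₁] and `CMWeights[]`** (binders in this order; `HC_CM` load-bearing).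
THE CELL'S DELIVERABLE ON THE ANDRÉ AXIS IN WEIGHT FORM: `HC_AV_of_HC_CM_and_Bmin` with, in the place of `B_min`, the CANDIDATE (4-binder reading of (L);
not below N104, not minimal — F-ab-107) "the Hodge conjecture for the top-weight part
`H⁰(S, R^{2p} f_*ℚ)` of the total spaces of CM-pointed compact abelian pencils". research route, not a corollary; conditional on HC_CM plus one
named minimal statement. [cite: Andre1996Motifs, Lemme 6.3.1 (p. 31) and Remarque 2 (p. 33)] [cite: Milne2020HodgeClassesAV, proof of Prop. 1 (pp. 7–8)] -/
theorem HC_AV_of_HC_CM_of_cmTopWeightHodge (h₂₁ : andre1996_cmAnchoredPencil) (hW : CMWeights[]) (hCM : RankFourFaces.CMAbelianHodge)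
    (h : CMTopWeightHodge[]) : PadicSemiregularLift.HodgeAbelianVarieties :=
  HC_AV_of_HC_CM_and_cmFibreAlgebraicLift h₂₁ hCM (cmFibreAlgebraicLift_of_cmTopWeightHodge hW h)

/-- **EXACTNESS: `HC_AV ⟺ HC_CM ∧ [CM top-weight Hodge classes algebraic]`, granted [h₂₁], Verdier and `CMWeights[]`.**
[cite: Andre1996Motifs, Lemme 6.3.1 (p. 31) and Remarque 2 (p. 33)] [cite: Verdier1976, Cor. 5.1] [cite: Milne2020HodgeClassesAV, proof of Prop. 1 (pp. 7–8)] -/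
theorem HC_AV_iff_HC_CM_and_cmTopWeightHodge_of_verdier (h₂₁ : andre1996_cmAnchoredPencil) (hGT : Verdier1976_genericLocalTriviality)
    (hW : CMWeights[]) : PadicSemiregularLift.HodgeAbelianVarieties ↔ (RankFourFaces.CMAbelianHodge ∧ CMTopWeightHodge[]) :=
  ⟨fun h ↦ ⟨HC_CM_of_HC_AV h, cmTopWeightHodge_of_HC_AV_of_verdier hGT h⟩, fun h ↦ HC_AV_of_HC_CM_of_cmTopWeightHodge h₂₁ hW h.1 h.2⟩

/-- **W₆ in Hodge-weight form: `(W_E)₃ ∧ [at the E-power points of the compact sextic pencils: a weighted endomorphism, and every top-weight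
rational `(p+1,p+1)`-class of the SEVENFOLD is algebraic] ⟹ WeilSixfolds`** (the E-power fibre satisfies the Hodge conjecture — the tree's
`hodgeConjectureFor_fiberOver_of_mem_cmPowerLocus` — so §9 gives the lift in every degree; then parts XXII-d / XXI-b §7 / XIX-f). `HC_CM` IDLE; no
named fact; `(W_E)₃` OPEN. FIND-THE-CYCLE: `H⁰(S, R⁶ f_*ℚ) ⊂ H⁶(𝒳⁷)` consists of Hodge classes when the monodromy is large; show they are algebraic.
[cite: Milne2020HodgeClassesAV, proof of Prop. 1 (pp. 7–8)] [cite: vanGeemen1994HodgeAV, Thm. 6.12] [cite: Andre1996Motifs, Lemme 6.3.3 (p. 33)] -/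
theorem weilSixfolds_of_cmPowerWeilPencilsAt_of_topWeightHodge (hW : CMPowerAnchoredCompactWeilPencilsAt 3)
    (h : ∀ ⦃𝒳 S : SchemeOver ℂ⦄ (f : 𝒳 ⟶ S) (_ : IsCompactAbelianPencil f 6) (t : ComplexPoints S), t ∈ cmPowerLocus f 6 →
      ∃ (ν : 𝒳 ⟶ 𝒳) (_ : LocallyQuasiFinite ν.left) (N : ℕ), 2 ≤ N ∧
        (∀ (k : ℕ) (w : complexBetti 𝒳 k), complexBetti.map (fiberι f t) k (complexBetti.map ν k w) =
          ((N : ℂ) ^ k) • complexBetti.map (fiberι f t) k w) ∧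
        (∀ (k k₁ k₂ : ℕ), k₁ + 1 = k → k₂ + 1 = k₁ → ∀ w : complexBetti 𝒳 k, ∃ w₀ w₁ w₂ : complexBetti 𝒳 k,
          w = w₀ + w₁ + w₂ ∧ complexBetti.map ν k w₀ = ((N : ℂ) ^ k) • w₀ ∧ complexBetti.map ν k w₁ = ((N : ℂ) ^ k₁) • w₁ ∧
          complexBetti.map ν k w₂ = ((N : ℂ) ^ k₂) • w₂) ∧
        (∀ (k : ℕ) (G : complexBetti 𝒳 k), complexBetti.map ν k G = ((N : ℂ) ^ k) • G →
          complexBetti.map (fiberι f t) k G = 0 → G = 0) ∧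
        ∀ (p : ℕ) (y₀ : complexBetti 𝒳 (2 * (p + 1))),
          complexBetti.map ν (2 * (p + 1)) y₀ = ((N : ℂ) ^ (2 * (p + 1))) • y₀ → IsRationalClass y₀ →
          IsOfHodgeType (6 + 1) 𝒳 (2 * (p + 1)) (p + 1) (p + 1) y₀ → y₀ ∈ algebraicClasses 𝒳 (p + 1)) :
    Theses.SevenfoldWeilCensus.WeilSixfolds := by
  refine weilSixfolds_of_cmPowerWeilPencilsAt_of_primitiveLiftE hW ?_
  intro 𝒳 S f hf t ht K hKalg hKs r h2r hrd ξ hξ hP hI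
  obtain ⟨ν, _, N, hN, hwt, hwt₃, htop, hlift⟩ := h f hf t ht
  have hL : ∀ p : ℕ, (algebraicClasses (fiberOver f t) p).comap (complexBetti.map (fiberι f t) (2 * p)).hom ≤
      algebraicClasses 𝒳 p ⊔ LinearMap.ker (complexBetti.map (fiberι f t) (2 * p)).hom := by
    intro p
    cases p with
    | zero => exact comap_le_sup_of_extreme hf t (show 0 + 6 = 6 by omega) (Or.inl (by omega))
    | succ p =>
      exact comap_le_sup_of_forall_topWeight_hodge_mem hf t ν hN (hwt _) (hwt₃ (2 * (p + 1)) (2 * p + 1) (2 * p) (by omega) (by omega))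
        (htop _) (hlift p)
  exact (forall_comap_le_sup_iff_primitiveLift hf t hKalg hKs).1 hL r h2r hrd ξ hξ hP hI

end Rows

end Summit.HodgeConjecture.HodgeConjecture.Ring2.AbelianAll

end
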